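import Summits.QuantumFields.BalabanUV.Beta.EriceFlowEnclosureLogPeriodicSums

/-!
# Beta / EriceFlowEnclosureLogPeriodicLaw — SERVICE FILE (2∕3): THE LOG-PERIODIC LAW OF AN ALMOST-UNIT-STEP SEQUENCE.  For
# `u : ℕ → ℝ` with `u ≥ 2` and `u_{j+1} − u_j = 1 − sin(log u_{j+1})∕u_{j+1}²` — the recursion (3.62) `1∕h_j − 1∕h_{j+1} = β(h_{j+1})` in
# inverse units `u = 1∕h` for the toy limit `β(t) = −1 − t²·sin(log t)` of P2 #45 ((T) with β₀ = −1, β₂ = 0 and NOTHING finer) —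
# `E j := u j − j` ((3.76)'s «O(1)» along the trajectory) converges to some c and
#        **`|E K − c − (sin(log u_K) + cos(log u_K))∕(2u_K)| ≤ 6∕(K+1)²`**   for every K
# (β-flow team, prover 2 = lower ∕ positivity side, unit `b2b-balaban-beta-bflow-p2`, gen 28; module P2 #45-B over P2 #45-A
# `EriceFlowEnclosureLogPeriodicSums`; continued in P2 #45-C `EriceFlowEnclosureLogPeriodicLetter`)

HONEST FRAMING (page 1 of everything the β sub-cell writes): discharging `BetaPertH` makes Bałaban's UV stability UNCONDITIONAL — a
real constructive-QFT result; it is NOT the continuum limit and NOT the Clay problem.  HONEST DEPENDENCY (cell reorg 2026-08-19,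
verbatim): «continuum YM on T⁴ ⇐ BetaPertH ∧ nine spine estimates (0/9 proved); BetaPertH ⇐ (D1) ∧ (D4) ∧ CAP+tail; G-an2-4 gates
asym, D1 and NE2/3/4.»  THIS MODULE DISCHARGES NOTHING: [folklore] real analysis of ONE real sequence (no β-function, no lattice, no
interface); consumed by P2 #45, a TOY witness about the hypothesis classes of the cell's theorems.

THE POINT.  With `F(x) = (sin log x + cos log x)∕(2x)`, `F′ = −f`, `f(x) = sin(log x)∕x²` (P2 #45-A): `E_{j+1} − E_j = −f(u_{j+1})`
(`E_step`), the step `Δ_j = u_{j+1} − u_j ∈ [3∕4, 5∕4]` (`step_bounds`), `u_j ≥ 2 + (3∕4)j` (`seq_lower`), `|E_j − E_0| ≤ 2∕3`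
(`E_sub_E0_le`); the mean value theorem on `[u_j, u_{j+1}]` writes the one-step DEFECT of `G := E − F∘u` as
`(f ξ − f u_{j+1}) + f ξ·(Δ_j − 1)`, of size `≤ (3∕u_j³)(5∕4) + 1∕u_j⁴ ≤ 5∕u_j³` (`defect_step_le` — the heart); summing,
`|G_N − G_K| ≤ 6∕(K+1)²` (`defect_window_le`); so G is Cauchy (ℝ complete), `|F(u_K)| ≤ 1∕u_K → 0`, E → c := lim G, and N → ∞ in
the window gives the HEADLINE **`logPeriodic_law`**.  THE 1∕K TERM OF E IS THE LOG-PERIODIC `F(u_K)`, NOT A LETTER∕K.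

WHAT THIS FILE PROVES (0 sorry, 0 def): `step_bounds`, `seq_lower`, `seq_lower_from`, `E_step`, `E_sub_E0_le`, **`defect_step_le`**,
`defect_window_le`, **`logPeriodic_law`**.
NOT CLAIMED: anything about a β-function, (3.62), (3.76), (1.22), `BetaPertH`, continuum, Clay — see P2 #45 for the (toy) β-side reading.
-/

namespace Summit.QuantumFields.BalabanUV.Beta.EriceFlowEnclosureLogPeriodicLaw

open Set Filter Topology
open Summit.QuantumFields.BalabanUV.Beta.EriceFlowEnclosureLogPeriodicSums

noncomputable section

/-! ## §2 The almost-unit-step sequence: defect, window, the log-periodic law -/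

section Seq

variable {u : ℕ → ℝ}

/-- Step bounds: `|u_{j+1} − u_j − 1| ≤ 1∕u_{j+1}² ≤ 1∕4`, so `3∕4 ≤ u_{j+1} − u_j ≤ 5∕4`. [folklore] -/
theorem step_bounds (hu2 : ∀ j, 2 ≤ u j)
    (hstep : ∀ j, u (j + 1) - u j = 1 - Real.sin (Real.log (u (j + 1))) / u (j + 1) ^ 2) (j : ℕ) :
    |u (j + 1) - u j - 1| ≤ 1 / u (j + 1) ^ 2 ∧ 3 / 4 ≤ u (j + 1) - u j ∧ u (j + 1) - u j ≤ 5 / 4 := by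
  have hb : 2 ≤ u (j + 1) := hu2 (j + 1)
  have hb0 : 0 < u (j + 1) := by linarith
  have hf : |Real.sin (Real.log (u (j + 1))) / u (j + 1) ^ 2| ≤ 1 / u (j + 1) ^ 2 := abs_f_le hb0
  have hq : 1 / u (j + 1) ^ 2 ≤ 1 / 4 := by
    rw [div_le_div_iff₀ (by positivity) (by norm_num)]
    nlinarith
  have h1 : |u (j + 1) - u j - 1| ≤ 1 / u (j + 1) ^ 2 := by
    rw [hstep j, show (1 : ℝ) - Real.sin (Real.log (u (j + 1))) / u (j + 1) ^ 2 - 1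
      = -(Real.sin (Real.log (u (j + 1))) / u (j + 1) ^ 2) by ring, abs_neg]
    exact hf
  have h2 := (abs_le.mp (h1.trans hq))
  exact ⟨h1, by linarith [h2.1], by linarith [h2.2]⟩

/-- The linear lower bound `2 + (3∕4)·j ≤ u_j`. [folklore] -/
theorem seq_lower (hu2 : ∀ j, 2 ≤ u j)
    (hstep : ∀ j, u (j + 1) - u j = 1 - Real.sin (Real.log (u (j + 1))) / u (j + 1) ^ 2) (j : ℕ) :
    2 + 3 / 4 * (j : ℝ) ≤ u j := by
  induction j with
  | zero => simpa using hu2 0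
  | succ j ih =>
    have h := (step_bounds hu2 hstep j).2.1
    push_cast
    linarith

/-- The linear lower bound from any index: `u_K + (3∕4)·(i − K) ≤ u_i` for `K ≤ i`. [folklore] -/
theorem seq_lower_from (hu2 : ∀ j, 2 ≤ u j)
    (hstep : ∀ j, u (j + 1) - u j = 1 - Real.sin (Real.log (u (j + 1))) / u (j + 1) ^ 2) {K i : ℕ} (hKi : K ≤ i) :
    u K + 3 / 4 * ((i : ℝ) - K) ≤ u i := by
  induction i, hKi using Nat.le_induction with
  | base => simp
  | succ i hKi ih =>
    have h := (step_bounds hu2 hstep i).2.1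
    push_cast
    linarith

/-- The one-step identity for `E j := u j − j`: `E_{j+1} − E_j = −sin(log u_{j+1})∕u_{j+1}²`. [folklore] -/
theorem E_step (hstep : ∀ j, u (j + 1) - u j = 1 - Real.sin (Real.log (u (j + 1))) / u (j + 1) ^ 2) (j : ℕ) :
    (u (j + 1) - ((j : ℝ) + 1)) - (u j - j) = -(Real.sin (Real.log (u (j + 1))) / u (j + 1) ^ 2) := by
  linear_combination hstep j

/-- `E` stays within 1 of its start: `|E_j − E_0| ≤ 2∕3` (the steps are `≤ 1∕u_{i+1}² ≤ (16∕9)∕(i + 11∕3)²`, §0). [folklore] -/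
theorem E_sub_E0_le (hu2 : ∀ j, 2 ≤ u j)
    (hstep : ∀ j, u (j + 1) - u j = 1 - Real.sin (Real.log (u (j + 1))) / u (j + 1) ^ 2) (j : ℕ) :
    |(u j - j) - u 0| ≤ 2 / 3 := by
  have htel : (u j - j) - u 0 = ∑ i ∈ Finset.range j, ((u (i + 1) - ((i : ℝ) + 1)) - (u i - i)) := by
    have h := Finset.sum_range_sub (fun i => u i - (i : ℝ)) j
    push_cast at h
    rw [h]
    ring
  have hterm : ∀ i ∈ Finset.range j, |(u (i + 1) - ((i : ℝ) + 1)) - (u i - i)| ≤ 16 / 9 * (1 / ((i : ℝ) + 11 / 3) ^ 2) := by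
    intro i _
    rw [E_step hstep i, abs_neg]
    have hb0 : 0 < u (i + 1) := by linarith [hu2 (i + 1)]
    have hlow : 2 + 3 / 4 * ((i : ℝ) + 1) ≤ u (i + 1) := by
      have := seq_lower hu2 hstep (i + 1); push_cast at this; exact this
    refine (abs_f_le hb0).trans ?_
    calc 1 / u (i + 1) ^ 2 ≤ 1 / (3 / 4 * ((i : ℝ) + 11 / 3)) ^ 2 :=
          one_div_le_one_div_of_le (by positivity) (pow_le_pow_left₀ (by positivity) (by linarith) 2)
      _ = 16 / 9 * (1 / ((i : ℝ) + 11 / 3) ^ 2) := by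
          have hne : (i : ℝ) + 11 / 3 ≠ 0 := by positivity
          field_simp
          ring
  have hsum : ∑ i ∈ Finset.range j, 1 / ((i : ℝ) + 11 / 3) ^ 2 ≤ 3 / 8 := by
    have h := sum_Ico_inv_add_sq_le (p := 11 / 3) (by norm_num) (Nat.zero_le j)
    rw [← Finset.range_eq_Ico] at h
    have h0 : 0 ≤ 1 / ((j : ℝ) + 11 / 3 - 1) := by
      have : (0 : ℝ) ≤ j := j.cast_nonneg
      exact div_nonneg zero_le_one (by linarith)
    have e : (1 : ℝ) / (((0 : ℕ) : ℝ) + 11 / 3 - 1) = 3 / 8 := by norm_num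
    rw [e] at h
    linarith
  rw [htel]
  calc |∑ i ∈ Finset.range j, ((u (i + 1) - ((i : ℝ) + 1)) - (u i - i))|
      ≤ ∑ i ∈ Finset.range j, |(u (i + 1) - ((i : ℝ) + 1)) - (u i - i)| := Finset.abs_sum_le_sum_abs _ _
    _ ≤ ∑ i ∈ Finset.range j, 16 / 9 * (1 / ((i : ℝ) + 11 / 3) ^ 2) := Finset.sum_le_sum hterm
    _ = 16 / 9 * ∑ i ∈ Finset.range j, 1 / ((i : ℝ) + 11 / 3) ^ 2 := by rw [Finset.mul_sum]
    _ ≤ 16 / 9 * (3 / 8) := by gcongr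
    _ = 2 / 3 := by norm_num

/-- **THE ONE-STEP DEFECT (the heart of the file)**: with `E j = u j − j` and `F(x) = (sin log x + cos log x)∕(2x)`,
`|(E_{j+1} − F(u_{j+1})) − (E_j − F(u_j))| ≤ 5∕u_j³` — mean value on `[u_j, u_{j+1}]` gives `F(u_j) − F(u_{j+1}) = f(ξ)·Δ`, so the defect is
`(f ξ − f u_{j+1}) + f ξ·(Δ − 1)` with `|f ξ − f u_{j+1}| ≤ (3∕u_j³)·(5∕4)` and `|f ξ·(Δ − 1)| ≤ 1∕u_j⁴ ≤ 1∕(2u_j³)`. [folklore] -/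
theorem defect_step_le (hu2 : ∀ j, 2 ≤ u j)
    (hstep : ∀ j, u (j + 1) - u j = 1 - Real.sin (Real.log (u (j + 1))) / u (j + 1) ^ 2) (j : ℕ) :
    |((u (j + 1) - ((j : ℝ) + 1)) - (Real.sin (Real.log (u (j + 1))) + Real.cos (Real.log (u (j + 1)))) / (2 * u (j + 1)))
        - ((u j - j) - (Real.sin (Real.log (u j)) + Real.cos (Real.log (u j))) / (2 * u j))|
      ≤ 5 / u j ^ 3 := by
  have ha2 : 2 ≤ u j := hu2 j
  have ha0 : 0 < u j := by linarith
  obtain ⟨hΔ1, hΔlo, hΔhi⟩ := step_bounds hu2 hstep j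
  have hab : u j < u (j + 1) := by linarith
  have hb0 : 0 < u (j + 1) := ha0.trans hab
  -- mean value on [u j, u (j + 1)]
  obtain ⟨ξ, hξ, hmvt⟩ := F_mvt ha0 hab
  have hξa : u j ≤ ξ := hξ.1.le
  have hξ0 : 0 < ξ := ha0.trans hξ.1
  -- the algebraic decomposition of the defect
  have hE : (u (j + 1) - ((j : ℝ) + 1)) - (u j - j) = -(Real.sin (Real.log (u (j + 1))) / u (j + 1) ^ 2) := E_step hstep j
  have hdec : ((u (j + 1) - ((j : ℝ) + 1)) - (Real.sin (Real.log (u (j + 1))) + Real.cos (Real.log (u (j + 1)))) / (2 * u (j + 1)))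
        - ((u j - j) - (Real.sin (Real.log (u j)) + Real.cos (Real.log (u j))) / (2 * u j))
      = (Real.sin (Real.log ξ) / ξ ^ 2 - Real.sin (Real.log (u (j + 1))) / u (j + 1) ^ 2)
        + Real.sin (Real.log ξ) / ξ ^ 2 * ((u (j + 1) - u j) - 1) := by
    linear_combination hE + hmvt
  rw [hdec]
  -- the two pieces
  have h1 : |Real.sin (Real.log ξ) / ξ ^ 2 - Real.sin (Real.log (u (j + 1))) / u (j + 1) ^ 2| ≤ 3 / u j ^ 3 * (5 / 4) := by
    refine (f_lipschitz ha0 hξa hab.le).trans ?_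
    refine mul_le_mul_of_nonneg_left ?_ (by positivity)
    rw [abs_sub_comm, abs_of_pos (by linarith [hξ.2])]
    linarith [hξ.1]
  have h2 : |Real.sin (Real.log ξ) / ξ ^ 2 * ((u (j + 1) - u j) - 1)| ≤ 1 / u j ^ 2 * (1 / u j ^ 2) := by
    rw [abs_mul]
    refine mul_le_mul ((abs_f_le hξ0).trans ?_) (hΔ1.trans ?_) (abs_nonneg _) (by positivity)
    · exact div_le_div_of_nonneg_left zero_le_one (pow_pos ha0 2) (pow_le_pow_left₀ ha0.le hξa 2)
    · exact div_le_div_of_nonneg_left zero_le_one (pow_pos ha0 2) (pow_le_pow_left₀ ha0.le hab.le 2)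
  have h3 : 1 / u j ^ 2 * (1 / u j ^ 2) ≤ 1 / (2 * u j ^ 3) := by
    rw [div_mul_div_comm, one_mul, div_le_div_iff₀ (by positivity) (by positivity)]
    nlinarith [pow_pos ha0 3]
  calc |(Real.sin (Real.log ξ) / ξ ^ 2 - Real.sin (Real.log (u (j + 1))) / u (j + 1) ^ 2)
          + Real.sin (Real.log ξ) / ξ ^ 2 * ((u (j + 1) - u j) - 1)|
      ≤ |Real.sin (Real.log ξ) / ξ ^ 2 - Real.sin (Real.log (u (j + 1))) / u (j + 1) ^ 2|
          + |Real.sin (Real.log ξ) / ξ ^ 2 * ((u (j + 1) - u j) - 1)| := abs_add_le _ _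
    _ ≤ 3 / u j ^ 3 * (5 / 4) + 1 / (2 * u j ^ 3) := add_le_add h1 (h2.trans h3)
    _ = (17 / 4) / u j ^ 3 := by field_simp; ring
    _ ≤ 5 / u j ^ 3 := div_le_div_of_nonneg_right (by norm_num) (pow_pos ha0 3).le

/-- **The window estimate**: for `K ≤ N`, `|(E_N − F(u_N)) − (E_K − F(u_K))| ≤ 6∕(K+1)²` (the defects summed: `5∕u_i³ ≤ 5·(64∕27)∕(i + 8∕3)³`
and §0 `sum_Ico_inv_add_cube_le`). [folklore] -/
theorem defect_window_le (hu2 : ∀ j, 2 ≤ u j)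
    (hstep : ∀ j, u (j + 1) - u j = 1 - Real.sin (Real.log (u (j + 1))) / u (j + 1) ^ 2) {K N : ℕ} (hKN : K ≤ N) :
    |((u N - N) - (Real.sin (Real.log (u N)) + Real.cos (Real.log (u N))) / (2 * u N))
        - ((u K - K) - (Real.sin (Real.log (u K)) + Real.cos (Real.log (u K))) / (2 * u K))|
      ≤ 6 / ((K : ℝ) + 1) ^ 2 := by
  set G : ℕ → ℝ := fun i => (u i - i) - (Real.sin (Real.log (u i)) + Real.cos (Real.log (u i))) / (2 * u i) with hG
  have htel : G N - G K = ∑ i ∈ Finset.Ico K N, (G (i + 1) - G i) := by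
    have h1 := Finset.sum_range_add_sum_Ico (fun i => G (i + 1) - G i) hKN
    rw [Finset.sum_range_sub, Finset.sum_range_sub] at h1
    linarith
  have hterm : ∀ i ∈ Finset.Ico K N, |G (i + 1) - G i| ≤ 320 / 27 * (1 / ((i : ℝ) + 8 / 3) ^ 3) := by
    intro i _
    have h := defect_step_le hu2 hstep i
    simp only [hG]
    push_cast at h ⊢
    refine h.trans ?_
    have hlow : 3 / 4 * ((i : ℝ) + 8 / 3) ≤ u i := by have := seq_lower hu2 hstep i; linarith
    have hpos : (0 : ℝ) < 3 / 4 * ((i : ℝ) + 8 / 3) := by positivity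
    calc 5 / u i ^ 3 ≤ 5 / (3 / 4 * ((i : ℝ) + 8 / 3)) ^ 3 :=
          div_le_div_of_nonneg_left (by norm_num) (pow_pos hpos 3) (pow_le_pow_left₀ hpos.le hlow 3)
      _ = 320 / 27 * (1 / ((i : ℝ) + 8 / 3) ^ 3) := by field_simp; ring
  have hsum : ∑ i ∈ Finset.Ico K N, 1 / ((i : ℝ) + 8 / 3) ^ 3 ≤ (1 / ((K : ℝ) + 1) ^ 2) / 2 := by
    have h := sum_Ico_inv_add_cube_le (p := 8 / 3) (by norm_num) hKN
    have hK0 : (0 : ℝ) ≤ K := K.cast_nonneg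
    have hN0 : (0 : ℝ) ≤ N := N.cast_nonneg
    have h1 : 0 ≤ 1 / ((N : ℝ) + 8 / 3 - 1) ^ 2 := by positivity
    have h2 : 1 / ((K : ℝ) + 8 / 3 - 1) ^ 2 ≤ 1 / ((K : ℝ) + 1) ^ 2 :=
      one_div_le_one_div_of_le (by positivity) (pow_le_pow_left₀ (by positivity) (by linarith) 2)
    linarith
  have hGoal : |G N - G K| ≤ 6 / ((K : ℝ) + 1) ^ 2 := by
    calc |G N - G K| = |∑ i ∈ Finset.Ico K N, (G (i + 1) - G i)| := by rw [htel]
      _ ≤ ∑ i ∈ Finset.Ico K N, |G (i + 1) - G i| := Finset.abs_sum_le_sum_abs _ _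
      _ ≤ ∑ i ∈ Finset.Ico K N, 320 / 27 * (1 / ((i : ℝ) + 8 / 3) ^ 3) := Finset.sum_le_sum hterm
      _ = 320 / 27 * ∑ i ∈ Finset.Ico K N, 1 / ((i : ℝ) + 8 / 3) ^ 3 := by rw [Finset.mul_sum]
      _ ≤ 320 / 27 * ((1 / ((K : ℝ) + 1) ^ 2) / 2) := by gcongr
      _ = 160 / 27 * (1 / ((K : ℝ) + 1) ^ 2) := by ring
      _ ≤ 6 * (1 / ((K : ℝ) + 1) ^ 2) :=
          mul_le_mul_of_nonneg_right (by norm_num) (by positivity)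
      _ = 6 / ((K : ℝ) + 1) ^ 2 := by ring
  simpa only [hG] using hGoal

/-- **THE LOG-PERIODIC LAW (HEADLINE).**  For `u ≥ 2` with the almost-unit step `u_{j+1} − u_j = 1 − sin(log u_{j+1})∕u_{j+1}²`:
`E j := u j − j` converges to some c and **`|E K − c − (sin(log u_K) + cos(log u_K))∕(2u_K)| ≤ 6∕(K+1)²` for every K** —
the defect sequence `E − F∘u` is Cauchy by the window estimate (ℝ complete), `|F(u_K)| ≤ 1∕u_K → 0`. [folklore] -/
theorem logPeriodic_law (hu2 : ∀ j, 2 ≤ u j)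
    (hstep : ∀ j, u (j + 1) - u j = 1 - Real.sin (Real.log (u (j + 1))) / u (j + 1) ^ 2) :
    ∃ c : ℝ, Tendsto (fun K : ℕ => u K - K) atTop (𝓝 c) ∧
      ∀ K : ℕ, |(u K - K) - c - (Real.sin (Real.log (u K)) + Real.cos (Real.log (u K))) / (2 * u K)|
        ≤ 6 / ((K : ℝ) + 1) ^ 2 := by
  set G : ℕ → ℝ := fun i => (u i - i) - (Real.sin (Real.log (u i)) + Real.cos (Real.log (u i))) / (2 * u i) with hG
  have hwin : ∀ K N : ℕ, K ≤ N → |G N - G K| ≤ 6 / ((K : ℝ) + 1) ^ 2 := fun K N hKN => by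
    simpa only [hG] using defect_window_le hu2 hstep hKN
  -- G is Cauchy
  have hCauchy : CauchySeq G := by
    refine Metric.cauchySeq_iff'.mpr fun ε hε => ?_
    obtain ⟨K, hK⟩ := exists_nat_gt (6 / ε)
    refine ⟨K, fun N hN => ?_⟩
    rw [Real.dist_eq]
    have hK1 : (0 : ℝ) < (K : ℝ) + 1 := by positivity
    have hKε : 6 / ((K : ℝ) + 1) ^ 2 < ε := by
      rw [div_lt_iff₀ (by positivity)]
      have h1 : 6 < (K : ℝ) * ε := by rwa [div_lt_iff₀ hε] at hK
      have hK0 : (0 : ℝ) ≤ K := K.cast_nonneg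
      have h2 : (K : ℝ) ≤ ((K : ℝ) + 1) ^ 2 := by nlinarith
      calc (6 : ℝ) < (K : ℝ) * ε := h1
        _ ≤ ((K : ℝ) + 1) ^ 2 * ε := mul_le_mul_of_nonneg_right h2 hε.le
        _ = ε * ((K : ℝ) + 1) ^ 2 := mul_comm _ _
    exact (hwin K N hN).trans_lt hKε
  obtain ⟨g, hg⟩ := cauchySeq_tendsto_of_complete hCauchy
  -- F(u K) → 0
  have hF0 : Tendsto (fun K : ℕ => (Real.sin (Real.log (u K)) + Real.cos (Real.log (u K))) / (2 * u K)) atTop (𝓝 0) := by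
    have hmaj : Tendsto (fun K : ℕ => 1 / (2 + 3 / 4 * (K : ℝ))) atTop (𝓝 0) := by
      have h1 : Tendsto (fun K : ℕ => 2 + 3 / 4 * (K : ℝ)) atTop atTop :=
        tendsto_atTop_add_const_left _ _ (Tendsto.const_mul_atTop (by norm_num) tendsto_natCast_atTop_atTop)
      refine h1.inv_tendsto_atTop.congr fun K => ?_
      simp only [Pi.inv_apply, one_div]
    refine squeeze_zero_norm (fun K => ?_) hmaj
    have hK0 : 0 < u K := by linarith [hu2 K]
    rw [Real.norm_eq_abs]
    refine (abs_F_le hK0).trans ?_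
    exact one_div_le_one_div_of_le (by positivity) (seq_lower hu2 hstep K)
  refine ⟨g, ?_, fun K => ?_⟩
  · have h := hg.add hF0
    rw [add_zero] at h
    refine h.congr fun K => ?_
    simp only [hG]
    ring
  · -- |G K − g| ≤ 6∕(K+1)² by passing to the limit N → ∞ in the window
    have hlim : Tendsto (fun N => |G N - G K|) atTop (𝓝 |g - G K|) :=
      (continuous_abs.tendsto _).comp (hg.sub_const (G K))
    have hbd : ∀ᶠ N in atTop, |G N - G K| ≤ 6 / ((K : ℝ) + 1) ^ 2 := by
      filter_upwards [Filter.eventually_ge_atTop K] with N hN using hwin K N hN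
    have h := le_of_tendsto hlim hbd
    rw [abs_sub_comm] at h
    have e : (u K - K) - g - (Real.sin (Real.log (u K)) + Real.cos (Real.log (u K))) / (2 * u K) = G K - g := by
      simp only [hG]; ring
    rw [e]
    exact h

end Seq

end

end Summit.QuantumFields.BalabanUV.Beta.EriceFlowEnclosureLogPeriodicLaw
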